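import Summits.QuantumFields.YangMills.Theorems.SqueezedSkewnessAntipodalReflectedDictionary
import Summits.QuantumFields.YangMills.Theorems.BalabanLadderNTMarkovMirror
import Summits.QuantumFields.YangMills.Theorems.SqueezedSkewnessAntipodalMarkovDictionary
import HarnessLib

/-!
# Route `SqueezedSkewness`, crux `AntipodalMirrorCeiling` (stmt-QuantumFields-23202), LINE «Markov ceiling» (planner ym-idea-6 g11, v2 @9a38efe2):
# TRANSPORT FOR THE TWIN `AntipodalMixing → BoundaryResponseMixing`, PART I — pull-back of `ℤ⁴` observables to the `Fin` torus and
# locality near the antipodal site (part II, `…AntipodalMixingTwin`: spatial translation of the cube and the twin itself)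

* §1 [folklore] the pull-back `Φ̂ V := Φ (torusLift P (configPerm (finRotate 4) (finTorusConfigEquivSite⁻¹ V)))` and the GENERAL reflected
  dictionary `Cov_P(Φ̂ ∘ reflFT, Φ̂') = torusE-Cov(Φ ∘ Θ₀, Φ')` (`covF_pullback_reflFT`; via `SqueezedSkewnessAntipodalReflectedDictionary.
  reflFT_equiv_configPerm`, `torusLift_negReflect`, `wilsonExpectation_configPerm`);
* §2 [folklore] `pullback_apply` (the pull-back reads the `ℤ⁴` link `((y₀, y⃗), i)` at the `Fin` link `((y⃗, y₀) mod P, i − 1)`), the two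
  torus-distance tests `min_val_le_of_window` / `min_natAbs_le_of_window`, and ★ `pullback_kerE_local`: for a cube at the spatial origin
  inside the X2 window straddling the slice `h` and a site of depth `≥ 1`, the pulled-back boundary response `kerE_Q(dens z)` reads only
  links within torus sup-distance `b + 1` of `x₀ = (0⃗, h)` (`MarkovMirror.isCylinder_kerE` + `kerE_supp_window`);
* §3 [folklore] spatial translations: `torusE` is translation invariant (`OSLegsFromFemtoAndGap.torusE_comp_configShift`), spatial
  translations commute with `Θ₀` (`cfgReflect_configShift`), `kerE_{Q+v}^{θ_v V}(dens (z+v)) = kerE_Q^V(dens z)`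
  (`BoundaryLaw.kerE_configShift`, `dens_configShift`) ⇒ ★ `torusCov_kerE_dens_translate`;
* §4 ★ `boundaryResponseMixing_of_antipodalMixing`: sup-normalised antipodal mixing (the route item `AntipodalMixing`, unfolded) implies
  boundary-response mixing (the narrow twin `stub_boundaryResponseMixing`, unfolded): translate the cube to the spatial origin, pull back
  `F = (kerE_Q(dens z) − m)/s` (measurable by `Reference.continuous_kerE`, `|F| ≤ 1`, local with radius `b + 1`), apply mixing with
  `ℓ_A = 2ℓ` (so `(b+1)·a ≤ 2ℓ` once `a(β) < ℓ`) and tolerance `τ`, undo the affine rescaling (`MarkovMirror.torusCov_const_add`,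
  `torusE_const_mul`); the degenerate `s = 0` case is a constant response (`UVSeamRec.ResponsePinning.torusE_const`).

NOTE: the filed glue 23391 was closed in parallel by fleet lead ym-spine-19353-p1 g19 (`…AntipodalMarkovGlue`, direct route through
`AntipodalMixing`); this file serves the v2 NARROW route (`stub_markovGlueNarrow`, landed) and its comparison stub `stub_twinOfMixing`, and
reuses that seat's `AntipodalMarkovDictionary.configPerm_apply_symm`.

Width seat ym-line-sfw-p2-w5 g11 (cell ym-idea-1; free hands), `--supports stmt-QuantumFields-23202` (helper).  THEOREMS ONLY.  HONEST FRAMING: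
finite-lattice bookkeeping; `AntipodalMixing` (23390) and `FloorUnitFBL6` (23389) stay OPEN; no crux, NT statement, rung or summit is proved;
the Yang–Mills mass gap is NOT proved.
-/

set_option autoImplicit false

noncomputable section

namespace Summit.QuantumFields.YangMills.Theorems.SqueezedSkewnessAntipodalMixingTransport

open MeasureTheory Literature.MathematicalPhysics.QuantumFieldTheory Literature.MathematicalPhysics.QuantumLattice
open Literature.Probability.LatticeModels (Torus.proj Torus.proj_apply)
open Summit.QuantumFields.YangMills.Cruxes.OSLegsFromFemtoAndGap.DlrCollarTransfer (torusE kerE dens depth)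
open Summit.QuantumFields.YangMills.Theorems.ThermalDescentTorusDictionary
open Summit.QuantumFields.YangMills.Theorems.ThermalDescentReflection (negT reflFT)
open Summit.QuantumFields.YangMills.Theorems.SqueezedSkewnessAntipodalReflectedDictionary (reflFT_equiv_configPerm)

variable {G : Type} [Group G] [MeasurableSpace G]

/-! ## §1 The pull-back `Φ ↦ Φ̂` of `ℤ⁴`-observables to the `Fin`-torus (periodic lift ∘ axis rotation ∘ reindexing) -/

omit [Group G] in
/-- **The pull-back reads the reindexed rotated configuration as its periodic lift.** [folklore] -/
theorem lift_equiv_configPerm {L : ℕ} (U : GaugeConfig 4 (2 * L + 1) G) :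
    torusLift (2 * L + 1) (configPerm (finRotate 4)
        ((finTorusConfigEquivSite G (2 * L + 1)).symm
          (finTorusConfigEquivSite G (2 * L + 1) (configPerm (finRotate 4).symm U)))) =
      torusLift (2 * L + 1) U := by
  rw [MeasurableEquiv.symm_apply_apply, Summit.QuantumFields.YangMills.Theorems.AntipodalMarkovDictionary.configPerm_apply_symm]

/-- **The pull-back reads the route's reflection as `Θ₀ = cfgReflect` of the periodic lift.** [folklore] -/
theorem lift_equiv_reflFT_configPerm {L : ℕ} (U : GaugeConfig 4 (2 * L + 1) G) :
    torusLift (2 * L + 1) (configPerm (finRotate 4)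
        ((finTorusConfigEquivSite G (2 * L + 1)).symm
          (reflFT (finTorusConfigEquivSite G (2 * L + 1) (configPerm (finRotate 4).symm U))))) =
      cfgReflect (torusLift (2 * L + 1) U) := by
  rw [reflFT_equiv_configPerm, MeasurableEquiv.symm_apply_apply, Summit.QuantumFields.YangMills.Theorems.AntipodalMarkovDictionary.configPerm_apply_symm, torusLift_negReflect]

section Expectations

variable [TopologicalSpace G] [IsTopologicalGroup G] [CompactSpace G] [BorelSpace G] (r : LatticeRep G)

/-- **GENERAL REFLECTED TWO-POINT DICTIONARY**: for ANY observables `Φ, Φ'` of `ℤ⁴`-configurations and their pull-backs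
`Φ̂ V = Φ (lift (rotate (reindex⁻¹ V)))`, `E_P[(Φ̂ ∘ reflFT) · Φ̂'] = torusE[(Φ ∘ Θ₀) · Φ']` on the odd torus `P = 2L+1`. [folklore] -/
theorem eF_pullback_reflFT_mul (β : ℝ) (L : ℕ) (Φ Φ' : LGConfig 4 G → ℝ) :
    eF r β (2 * L + 1) (fun V =>
        Φ (torusLift (2 * L + 1) (configPerm (finRotate 4) ((finTorusConfigEquivSite G (2 * L + 1)).symm (reflFT V)))) *
          Φ' (torusLift (2 * L + 1) (configPerm (finRotate 4) ((finTorusConfigEquivSite G (2 * L + 1)).symm V)))) =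
      torusE G r β L (fun U => Φ (cfgReflect U) * Φ' U) := by
  rw [torusE_eq_wilsonExpectation, eF_eq_wilsonExpectation,
    ← wilsonExpectation_configPerm r β (2 * L + 1) (finRotate 4).symm
      (fun U => Φ (torusLift (2 * L + 1) (configPerm (finRotate 4)
          ((finTorusConfigEquivSite G (2 * L + 1)).symm (reflFT (finTorusConfigEquivSite G (2 * L + 1) U))))) *
        Φ' (torusLift (2 * L + 1) (configPerm (finRotate 4)
          ((finTorusConfigEquivSite G (2 * L + 1)).symm (finTorusConfigEquivSite G (2 * L + 1) U)))))]
  refine congrArg _ (funext fun U => ?_)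
  simp only [lift_equiv_reflFT_configPerm, lift_equiv_configPerm]

/-- **General reflected one-point dictionary**: `E_P[Φ̂ ∘ reflFT] = torusE[Φ ∘ Θ₀]`. [folklore] -/
theorem eF_pullback_reflFT (β : ℝ) (L : ℕ) (Φ : LGConfig 4 G → ℝ) :
    eF r β (2 * L + 1) (fun V =>
        Φ (torusLift (2 * L + 1) (configPerm (finRotate 4) ((finTorusConfigEquivSite G (2 * L + 1)).symm (reflFT V))))) =
      torusE G r β L (fun U => Φ (cfgReflect U)) := by
  rw [torusE_eq_wilsonExpectation, eF_eq_wilsonExpectation,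
    ← wilsonExpectation_configPerm r β (2 * L + 1) (finRotate 4).symm
      (fun U => Φ (torusLift (2 * L + 1) (configPerm (finRotate 4)
          ((finTorusConfigEquivSite G (2 * L + 1)).symm (reflFT (finTorusConfigEquivSite G (2 * L + 1) U))))))]
  refine congrArg _ (funext fun U => ?_)
  simp only [lift_equiv_reflFT_configPerm]

/-- **General one-point dictionary**: `E_P[Φ̂] = torusE[Φ]`. [folklore] -/
theorem eF_pullback (β : ℝ) (L : ℕ) (Φ : LGConfig 4 G → ℝ) :
    eF r β (2 * L + 1) (fun V =>
        Φ (torusLift (2 * L + 1) (configPerm (finRotate 4) ((finTorusConfigEquivSite G (2 * L + 1)).symm V)))) =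
      torusE G r β L Φ := by
  rw [torusE_eq_wilsonExpectation, eF_eq_wilsonExpectation,
    ← wilsonExpectation_configPerm r β (2 * L + 1) (finRotate 4).symm
      (fun U => Φ (torusLift (2 * L + 1) (configPerm (finRotate 4)
          ((finTorusConfigEquivSite G (2 * L + 1)).symm (finTorusConfigEquivSite G (2 * L + 1) U)))))]
  refine congrArg _ (funext fun U => ?_)
  simp only [lift_equiv_configPerm]

/-- **GENERAL REFLECTED COVARIANCE DICTIONARY**: `Cov_P(Φ̂ ∘ reflFT, Φ̂') = torusE-Cov(Φ ∘ Θ₀, Φ')`. [folklore] -/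
theorem covF_pullback_reflFT (β : ℝ) (L : ℕ) (Φ Φ' : LGConfig 4 G → ℝ) :
    eF r β (2 * L + 1) (fun V =>
        Φ (torusLift (2 * L + 1) (configPerm (finRotate 4) ((finTorusConfigEquivSite G (2 * L + 1)).symm (reflFT V)))) *
          Φ' (torusLift (2 * L + 1) (configPerm (finRotate 4) ((finTorusConfigEquivSite G (2 * L + 1)).symm V)))) -
        eF r β (2 * L + 1) (fun V =>
          Φ (torusLift (2 * L + 1) (configPerm (finRotate 4) ((finTorusConfigEquivSite G (2 * L + 1)).symm (reflFT V))))) *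
        eF r β (2 * L + 1) (fun V =>
          Φ' (torusLift (2 * L + 1) (configPerm (finRotate 4) ((finTorusConfigEquivSite G (2 * L + 1)).symm V)))) =
      torusE G r β L (fun U => Φ (cfgReflect U) * Φ' U) - torusE G r β L (fun U => Φ (cfgReflect U)) * torusE G r β L Φ' := by
  rw [eF_pullback_reflFT_mul, eF_pullback_reflFT, eF_pullback]

end Expectations

/-! ## §2 The pull-back read link by link; locality near the antipodal site -/

section Locality

omit [Group G] in
/-- The inverse reindexing, link by link. [folklore] -/
theorem finTorusConfigEquivSite_symm_apply {P : ℕ} [NeZero P] (U : FinTorusSite P P P P × Fin 4 → G) (e : Edge 4 P) :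
    (finTorusConfigEquivSite G P).symm U e = U ((finTorusSiteEquivSite P).symm e.1, e.2) := by
  have h : finTorusConfigEquivSite G P (fun e : Edge 4 P => U ((finTorusSiteEquivSite P).symm e.1, e.2)) = U := by
    funext l
    rw [coe_finTorusConfigEquivSite]
    simp
  have h2 := congrArg (finTorusConfigEquivSite G P).symm h
  rw [MeasurableEquiv.symm_apply_apply] at h2
  rw [← h2]

omit [Group G] in
/-- **The pull-back, link by link**: `Φ̂` reads the `ℤ⁴` link `e = (y, i)` at the `Fin`-torus link
`((y₁, y₂, y₃, y₀) mod P, i − 1 mod 4)` (time-first `ℤ⁴` ↔ time-last `Fin` torus). [folklore] -/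
theorem pullback_apply {L : ℕ} (U : FinTorusSite (2 * L + 1) (2 * L + 1) (2 * L + 1) (2 * L + 1) × Fin 4 → G)
    (e : Literature.MathematicalPhysics.QuantumLattice.ZdEdge 4) :
    torusLift (2 * L + 1) (configPerm (finRotate 4) ((finTorusConfigEquivSite G (2 * L + 1)).symm U)) e =
      U (((ZMod.finEquiv (2 * L + 1)).symm ((e.1 1 : ℤ) : ZMod (2 * L + 1)),
          (ZMod.finEquiv (2 * L + 1)).symm ((e.1 2 : ℤ) : ZMod (2 * L + 1)),
          (ZMod.finEquiv (2 * L + 1)).symm ((e.1 3 : ℤ) : ZMod (2 * L + 1)),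
          (ZMod.finEquiv (2 * L + 1)).symm ((e.1 0 : ℤ) : ZMod (2 * L + 1))), (finRotate 4).symm e.2) := by
  unfold torusLift
  rw [Function.comp_apply, configPerm_apply, finTorusConfigEquivSite_symm_apply]
  congr 1

/-- The torus distance test of the route (`near`): a coordinate `k ∈ [−1, b]` of `ℤ`, read modulo `P ≥ b + 2`, lies within torus
distance `b + 1` of `0`. [folklore] -/
theorem min_val_le_of_window {P b : ℕ} [NeZero P] (hP : b + 2 ≤ P) {k : ℤ} (hk1 : -1 ≤ k) (hk2 : k ≤ b) :
    min ((ZMod.finEquiv P).symm ((k : ℤ) : ZMod P)).val (P - ((ZMod.finEquiv P).symm ((k : ℤ) : ZMod P)).val) ≤ b + 1 := by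
  obtain ⟨n, rfl⟩ : ∃ n, P = n + 1 := ⟨P - 1, by have := NeZero.pos P; omega⟩
  have hval : ((((k : ℤ) : ZMod (n + 1))).val : ℤ) = k % (n + 1 : ℕ) := ZMod.val_intCast k
  have hsymm : ((ZMod.finEquiv (n + 1)).symm ((k : ℤ) : ZMod (n + 1))).val = (((k : ℤ) : ZMod (n + 1))).val := rfl
  rw [hsymm]
  by_cases hk : 0 ≤ k
  · have : ((((k : ℤ) : ZMod (n + 1))).val : ℤ) = k := by
      rw [hval]; exact Int.emod_eq_of_lt hk (by push_cast; omega)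
    have hv : (((k : ℤ) : ZMod (n + 1))).val ≤ b := by omega
    exact le_trans (min_le_left _ _) (by omega)
  · have hk' : k = -1 := by omega
    have hv : (((k : ℤ) : ZMod (n + 1))).val = n := by
      rw [hk']
      push_cast
      exact ZMod.val_neg_one n
    rw [hv]
    exact le_trans (min_le_right _ _) (by omega)

/-- The time test of the route (`near`): a time `t ∈ [c₀ − 1, c₀ + b]` with `1 ≤ c₀`, `c₀ + b + 1 ≤ P`, and the slice
`h ∈ [c₀, c₀ + b]`, read modulo `P`, lies within torus distance `b + 1` of `h`. [folklore] -/
theorem min_natAbs_le_of_window {P b : ℕ} [NeZero P] {c₀ h t : ℤ} (hc₀ : 1 ≤ c₀) (hcP : c₀ + b + 1 ≤ P)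
    (hh1 : c₀ ≤ h) (hh2 : h ≤ c₀ + b) (ht1 : c₀ - 1 ≤ t) (ht2 : t ≤ c₀ + b) :
    min (Int.natAbs ((((ZMod.finEquiv P).symm ((t : ℤ) : ZMod P)).val : ℤ) - h))
        (P - Int.natAbs ((((ZMod.finEquiv P).symm ((t : ℤ) : ZMod P)).val : ℤ) - h)) ≤ b + 1 := by
  obtain ⟨n, rfl⟩ : ∃ n, P = n + 1 := ⟨P - 1, by have := NeZero.pos P; omega⟩
  have hval : ((((t : ℤ) : ZMod (n + 1))).val : ℤ) = t % (n + 1 : ℕ) := ZMod.val_intCast t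
  have hsymm : ((ZMod.finEquiv (n + 1)).symm ((t : ℤ) : ZMod (n + 1))).val = (((t : ℤ) : ZMod (n + 1))).val := rfl
  rw [hsymm]
  have : ((((t : ℤ) : ZMod (n + 1))).val : ℤ) = t := by
    rw [hval]; exact Int.emod_eq_of_lt (by omega) (by push_cast; omega)
  rw [this]
  exact le_trans (min_le_left _ _) (by omega)

variable [TopologicalSpace G] [IsTopologicalGroup G] [CompactSpace G] [BorelSpace G] (r : LatticeRep G)

/-- **LOCALITY OF THE PULLED-BACK BOUNDARY RESPONSE near the antipodal site.**  For a cube `Q = (c, b)` at the spatial origin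
(`c j = 0`, `j ≠ 0`) inside the window (`1 ≤ c 0`, `c 0 + b + 3 ≤ L`) straddling the slice `h` (`c 0 ≤ h ≤ c 0 + b`), and a site
`z` of depth `≥ 1` in `Q`, the pull-back of `V ↦ kerE_Q^V(dens z)` to the `Fin`-torus `P = 2L+1` reads only links whose base site is
within torus sup-distance `b + 1` of `x₀ = (0⃗, h)` (`MarkovMirror.isCylinder_kerE` + `kerE_supp_window`). [folklore] -/
theorem pullback_kerE_local (β : ℝ) (c : Fin 4 → ℤ) (b L : ℕ) (hc0 : 1 ≤ c 0) (hcL : c 0 + (b : ℤ) + 3 ≤ L)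
    (hcj : ∀ j : Fin 4, j ≠ 0 → c j = 0) {h : ℤ} (hh1 : c 0 ≤ h) (hh2 : h ≤ c 0 + b)
    (z : Fin 4 → ℤ) (hz : 1 ≤ depth c b z)
    (U U' : FinTorusSite (2 * L + 1) (2 * L + 1) (2 * L + 1) (2 * L + 1) × Fin 4 → G)
    (hUU' : ∀ e : FinTorusSite (2 * L + 1) (2 * L + 1) (2 * L + 1) (2 * L + 1) × Fin 4,
      (min e.1.1.val (2 * L + 1 - e.1.1.val) ≤ b + 1 ∧ min e.1.2.1.val (2 * L + 1 - e.1.2.1.val) ≤ b + 1 ∧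
        min e.1.2.2.1.val (2 * L + 1 - e.1.2.2.1.val) ≤ b + 1 ∧
        min (Int.natAbs ((e.1.2.2.2.val : ℤ) - h)) (2 * L + 1 - Int.natAbs ((e.1.2.2.2.val : ℤ) - h)) ≤ b + 1) →
      U e = U' e) :
    kerE G r β c b (torusLift (2 * L + 1) (configPerm (finRotate 4) ((finTorusConfigEquivSite G (2 * L + 1)).symm U)))
        (dens G r z) =
      kerE G r β c b (torusLift (2 * L + 1) (configPerm (finRotate 4) ((finTorusConfigEquivSite G (2 * L + 1)).symm U')))
        (dens G r z) := by
  haveI : SecondCountableTopology G :=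
    (r.continuous.isClosedEmbedding r.injective).isEmbedding.secondCountableTopology
  -- the support of `dens z` sits in the window `[c, c + b]`
  have hS : ∀ e ∈ r.curvature.supp.image (fun e => (e.1 - -z, e.2)), ∀ j : Fin 4, c j ≤ e.1 j ∧ e.1 j ≤ c j + b := by
    intro e he j
    obtain ⟨h0, h1⟩ := Summit.QuantumFields.YangMills.Cruxes.OSLegsFromFemtoAndGap.DlrCollarTransfer.near_of_mem_supp_dens r he j
    have hd := hz
    unfold depth at hd
    have hdj := (Finset.le_inf'_iff _ _).1 hd j (Finset.mem_univ j)
    simp only [le_min_iff] at hdj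
    obtain ⟨hd1, hd2⟩ := hdj
    have e1 : 1 ≤ z j - c j + 1 := by
      have := Int.self_le_toNat (z j - c j + 1); omega
    have e2 : 1 ≤ c j + b - z j := by
      have := Int.self_le_toNat (c j + b - z j); omega
    constructor <;> omega
  have hcyl := Summit.QuantumFields.YangMills.Cruxes.NT.MarkovMirror.isCylinder_kerE G r β c b
    (Summit.QuantumFields.YangMills.Cruxes.OSLegsFromFemtoAndGap.DlrCollarTransfer.continuous_dens r z).measurable
    (Summit.QuantumFields.YangMills.Cruxes.OSLegsFromFemtoAndGap.DlrCollarTransfer.isCylinder_dens r z)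
  refine hcyl (fun e he => ?_)
  have hw := Summit.QuantumFields.YangMills.Cruxes.NT.MarkovMirror.kerE_supp_window hS (Finset.mem_coe.1 he)
  rw [pullback_apply, pullback_apply]
  apply hUU'
  dsimp only
  have hP : b + 2 ≤ 2 * L + 1 := by have := hw 0; omega
  refine ⟨min_val_le_of_window hP ?_ ?_, min_val_le_of_window hP ?_ ?_, min_val_le_of_window hP ?_ ?_,
    min_natAbs_le_of_window (P := 2 * L + 1) hc0 (by push_cast; omega) hh1 hh2 (hw 0).1 (hw 0).2⟩
  · have := hw 1; rw [hcj 1 (by decide)] at this; omega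
  · have := hw 1; rw [hcj 1 (by decide)] at this; omega
  · have := hw 2; rw [hcj 2 (by decide)] at this; omega
  · have := hw 2; rw [hcj 2 (by decide)] at this; omega
  · have := hw 3; rw [hcj 3 (by decide)] at this; omega
  · have := hw 3; rw [hcj 3 (by decide)] at this; omega

end Locality

end Summit.QuantumFields.YangMills.Theorems.SqueezedSkewnessAntipodalMixingTransport
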